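import Literature.AlgebraicGeometry.Resolution.AffineBlowupAlgebra
import Literature.AlgebraicGeometry.Resolution.AffineBlowupUniversal
import Literature.AlgebraicGeometry.Resolution.AffineBlowupCartier
import Literature.AlgebraicGeometry.Resolution.BlowupPrincipalCharts
import Literature.AlgebraicGeometry.Resolution.MarkedIdealsLemmas
import HarnessLib

/-!
# Charts of a blow-up: every blow-up is covered by spectra of affine blowup algebras

Topic: `Literature/AlgebraicGeometry/Resolution`. The Stacks Project, Tag 0804 (Lemma 31.32.2:
"Let `X = Spec A`, `Z = V(I)`, `b : X' → X` the blowing up of `X` in `Z`. Then … `b⁻¹(U)` has an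
affine open covering by spectra of the affine blowup algebras `A[I/a]`, `a ∈ I`") — here for a
blow-up in the sense of the universal property (`IsBlowup π C`, `Blowups.lean`, Görtz–Wedhorn I,
Def. 13.90) of an ARBITRARY scheme `X` along an arbitrary quasi-coherent ideal sheaf `C`:

* `IsBlowup.exists_blowupAlgebra_chart` — PROVED: every point `x' ∈ X'` lies in the image of an
  open immersion `g : Spec Γ(X, U)[C(U)/b] → X'` from the spectrum of an affine blowup algebra
  (`blowupAlgebra`, `AffineBlowupAlgebra.lean`), `U ⊆ X` an affine open and `b ∈ C(U)`, with
  `g ≫ π = Spec (Γ(X, U) → Γ(X, U)[C(U)/b]) ≫ (Spec Γ(X, U) → X)`;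
* `IsBlowup.exists_chart` — PROVED, the same on sections: affine opens `x' ∈ V ⊆ X'`, `U ⊆ X`
  with `π(V) ⊆ U`, `b ∈ C(U)`, and a ring isomorphism `Γ(X', V) ≅ Γ(X, U)[C(U)/b]` identifying
  `π^* : Γ(X, U) → Γ(X', V)` (`π.appLE U V`) with the structure map of the blowup algebra.

This is the bridge between the universal property and the chart-level algebra of the tree
(`AffineBlowupAlgebra.lean`, `DerivativeIdealsChart*.lean`, `BlowupChartRegular.lean`, …):
over an affine open `U = Spec R` the blow-up restricts to a blow-up of `U` (`IsBlowup.restrict`),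
which is isomorphic over `Spec R` to `Proj R[It]` (`affineBlowup.isBlowup` and uniqueness,
`IsBlowup.unique`), covered by the charts `D₊(bt) = Spec (R[It])_{(bt)}` (`affineBlowup.chartι`,
`affineBlowup.iSup_basicOpen_reesT_eq_top`), and `(R[It])_{(bt)} ≅ R[I/b]` over `R`
(`reesChartEquiv`).

It complements `BlowupPrincipalCharts.lean` (the open immersion `Bl_{C(U)}(Spec Γ(X, U)) → X'`
onto `π⁻¹(U)`, `IsBlowup.exists_chartImmersion`, and the principal charts `X'[U, g]` inside
`X'`), whose `comap_fromSpec`, `IsBlowup.restrict_isoSpec`, `appLE_congr_hom` and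
`fromSpec_appLE_top` are reused here; the point of the present file is the identification of the
chart RINGS with the subalgebras `Γ(X, U)[C(U)/b] ⊆ Γ(X, U)[1/b]` on which the chart-level
algebra of the tree is formulated.

Auxiliary [folklore]: `IsBlowup.exists_chartι_of_mem` (the chart in the model `(R[It])_{(bt)}`),
`IsBlowup.exists_blowupAlgebra_chart_of_mem` (the chart over a given affine open `U ∋ π x'`),
`image_top_le_preimage_of_comp_eq`, `appLE_appIso_ΓSpecIso_of_comp_eq` (sections of a chart `g`
with `g ≫ π = Spec f ≫ (Spec Γ(X,U) → X)`).

## Sources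

* The Stacks Project, Tag 0804 (Lemma 31.32.2), Tag 052Q (affine blowup algebras).
  [StacksProject]
* U. Görtz, T. Wedhorn, *Algebraic Geometry I*, 2nd ed. (2020), (13.19): Def. 13.90,
  Prop. 13.91, Prop. 13.92 and p. 415 (`Bl_Z(X)` glued from the `Spec A[I/f]`). [GortzWedhorn2020]
-/

noncomputable section

open CategoryTheory CategoryTheory.Limits AlgebraicGeometry TopologicalSpace

namespace Literature.AlgebraicGeometry.Resolution

universe u

/-! ## Bookkeeping on sections -/

/-- If `g ≫ π = Spec f ≫ (Spec Γ(X, U) → X)` then `g` maps into `π⁻¹(U)`. [folklore] -/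
theorem image_top_le_preimage_of_comp_eq {X' X : Scheme.{u}} (π : X' ⟶ X) {A : CommRingCat.{u}}
    (g : Spec A ⟶ X') [IsOpenImmersion g] (U : X.affineOpens) (f : Γ(X, U) ⟶ A)
    (h : g ≫ π = Spec.map f ≫ U.2.fromSpec) : g ''ᵁ ⊤ ≤ π ⁻¹ᵁ (U : X.Opens) := by
  rintro _ ⟨z, -, rfl⟩
  change π (g z) ∈ (U : X.Opens)
  rw [← Scheme.Hom.comp_apply, h, Scheme.Hom.comp_apply]
  exact U.2.range_fromSpec.le ⟨_, rfl⟩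

/-- **Sections of a chart.** If an open immersion `g : Spec A → X'` satisfies
`g ≫ π = Spec f ≫ (Spec Γ(X, U) → X)` for a ring map `f : Γ(X, U) → A`, then under
`Γ(X', g(Spec A)) ≅ Γ(Spec A, ⊤) ≅ A` the map `π^* : Γ(X, U) → Γ(X', g(Spec A))` becomes `f`.
[folklore] -/
theorem appLE_appIso_ΓSpecIso_of_comp_eq {X' X : Scheme.{u}} (π : X' ⟶ X) {A : CommRingCat.{u}}
    (g : Spec A ⟶ X') [IsOpenImmersion g] (U : X.affineOpens) (f : Γ(X, U) ⟶ A)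
    (h : g ≫ π = Spec.map f ≫ U.2.fromSpec) (hVU : g ''ᵁ ⊤ ≤ π ⁻¹ᵁ (U : X.Opens)) :
    π.appLE U (g ''ᵁ ⊤) hVU ≫ (g.appIso ⊤).hom ≫ (Scheme.ΓSpecIso A).hom = f := by
  have e₀ : (⊤ : (Spec A).Opens) ≤ (g ≫ π) ⁻¹ᵁ (U : X.Opens) := fun z _ => hVU ⟨z, trivial, rfl⟩
  have h1 : π.appLE U (g ''ᵁ ⊤) hVU ≫ (g.appIso ⊤).hom = (g ≫ π).appLE U ⊤ e₀ := by
    rw [Scheme.Hom.appIso_hom', Scheme.Hom.appLE_comp_appLE]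
  have h2 : (g ≫ π).appLE U ⊤ e₀ = f ≫ (Scheme.ΓSpecIso A).inv := by
    rw [appLE_congr_hom h]
    have e₁ : (⊤ : (Spec Γ(X, U)).Opens) ≤ U.2.fromSpec ⁻¹ᵁ (U : X.Opens) := by
      rw [U.2.fromSpec_preimage_self]
    rw [← Scheme.Hom.appLE_comp_appLE _ _ (U : X.Opens) ⊤ ⊤ e₁ le_top, fromSpec_appLE_top U e₁,
      Scheme.ΓSpecIso_inv_naturality]
    congr 1
  rw [← Category.assoc, h1, h2, Category.assoc, Iso.inv_hom_id, Category.comp_id]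

/-! ## The charts -/

/-- **The charts `Spec (R[It])_{(bt)}` of a blow-up over an affine open `U ∋ π x'`**
(`R = Γ(X, U)`, `I = C(U)`, `b ∈ I`): `x'` lies in the image of an open immersion
`g : Spec (R[It])_{(bt)} → X'` with `g ≫ π = Spec (R → (R[It])_{(bt)}) ≫ (Spec R → X)`.
[cite: StacksProject, Tag 0804] -/
theorem IsBlowup.exists_chartι_of_mem {X' X : Scheme.{u}} {π : X' ⟶ X} {C : X.IdealSheafData}
    (hπ : IsBlowup π C) (U : X.affineOpens) {x' : X'} (hxU : π x' ∈ (U : X.Opens)) :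
    ∃ (b : Γ(X, U)) (hb : b ∈ C.ideal U)
      (g : Spec (.of (HomogeneousLocalization.Away (reesGrading (C.ideal U)) (reesT b hb))) ⟶ X'),
      IsOpenImmersion g ∧ x' ∈ Set.range g ∧
        g ≫ π = Spec.map (CommRingCat.ofHom (reesChartBase b hb)) ≫ U.2.fromSpec := by
  classical
  -- the restricted blow-up is `Proj R[It]` over `Spec R`, `I = C(U)`
  obtain ⟨ε, -, hε'⟩ := (hπ.restrict_isoSpec U).unique (affineBlowup.isBlowup (C.ideal U))
  -- the chart containing the point over `x'`
  have hy : ε.hom ⟨x', hxU⟩ ∈ (⊤ : (affineBlowup (C.ideal U)).Opens) := trivial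
  rw [← affineBlowup.iSup_basicOpen_reesT_eq_top (C.ideal U)] at hy
  obtain ⟨⟨b, hb⟩, hyb⟩ := Opens.mem_iSup.mp hy
  refine ⟨b, hb, affineBlowup.chartι b hb ≫ ε.inv ≫ (π ⁻¹ᵁ (U : X.Opens)).ι, inferInstance, ?_, ?_⟩
  · -- `x'` is in the image
    have hyb' : ε.hom ⟨x', hxU⟩ ∈ affineBlowup.chartι b hb ''ᵁ ⊤ := by
      rwa [affineBlowup.image_top_chartι]
    obtain ⟨z, -, hz⟩ := hyb'
    replace hz : affineBlowup.chartι b hb z = ε.hom ⟨x', hxU⟩ := hz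
    refine ⟨z, ?_⟩
    rw [Scheme.Hom.comp_apply, hz, ← Scheme.Hom.comp_apply, Iso.hom_inv_id_assoc]
    rfl
  · -- `g ≫ π = Spec φ_b ≫ (Spec R → X)`
    rw [Category.assoc, Category.assoc, ← morphismRestrict_ι, ← U.2.isoSpec_hom_fromSpec,
      ← affineBlowup.chartι_π b hb, ← hε']
    simp only [Category.assoc]

/-- **Spectra of affine blowup algebras as charts over an affine open `U ∋ π x'`**: `x'` lies in
the image of an open immersion `g : Spec Γ(X, U)[C(U)/b] → X'`, `b ∈ C(U)`, with
`g ≫ π = Spec (Γ(X, U) → Γ(X, U)[C(U)/b]) ≫ (Spec Γ(X, U) → X)`. [cite: StacksProject, Tag 0804] -/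
theorem IsBlowup.exists_blowupAlgebra_chart_of_mem {X' X : Scheme.{u}} {π : X' ⟶ X}
    {C : X.IdealSheafData} (hπ : IsBlowup π C) (U : X.affineOpens) {x' : X'}
    (hxU : π x' ∈ (U : X.Opens)) :
    ∃ (b : Γ(X, U)) (_ : b ∈ C.ideal U) (g : Spec (.of (blowupAlgebra (C.ideal U) b)) ⟶ X'),
      IsOpenImmersion g ∧ x' ∈ Set.range g ∧
        g ≫ π = Spec.map (CommRingCat.ofHom (algebraMap Γ(X, U) (blowupAlgebra (C.ideal U) b))) ≫
          U.2.fromSpec := by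
  obtain ⟨b, hb, g, hg, hx', hgπ⟩ := hπ.exists_chartι_of_mem U hxU
  haveI := hg
  -- move the chart along `(R[It])_{(bt)} ≅ R[I/b]`
  let eqv : HomogeneousLocalization.Away (reesGrading (C.ideal U)) (reesT b hb) ≃+*
      blowupAlgebra (C.ideal U) b := reesChartEquiv b hb
  let e : CommRingCat.of (HomogeneousLocalization.Away (reesGrading (C.ideal U)) (reesT b hb)) ≅
      CommRingCat.of (blowupAlgebra (C.ideal U) b) := eqv.toCommRingCatIso
  refine ⟨b, hb, Spec.map e.hom ≫ g, inferInstance, ?_, ?_⟩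
  · obtain ⟨z, rfl⟩ := hx'
    refine ⟨Spec.map e.inv z, ?_⟩
    rw [Scheme.Hom.comp_apply, ← Scheme.Hom.comp_apply (Spec.map e.inv) (Spec.map e.hom),
      ← Spec.map_comp, Iso.hom_inv_id, Spec.map_id]
    rfl
  · rw [Category.assoc, hgπ, ← Spec.map_comp_assoc]
    refine congrArg (· ≫ U.2.fromSpec) (congrArg Spec.map ?_)
    apply CommRingCat.hom_ext
    apply RingHom.ext
    intro x
    exact reesChartEquiv_reesChartBase b hb x

/-- **Every blow-up is covered by spectra of affine blowup algebras** (Stacks, Tag 0804, for a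
blow-up in the sense of the universal property): for `π : X' → X` a blow-up along `C` and
`x' ∈ X'` there are an affine open `U ⊆ X`, `b ∈ C(U)`, and an open immersion
`g : Spec Γ(X, U)[C(U)/b] → X'` whose image contains `x'`, with
`g ≫ π = Spec (Γ(X, U) → Γ(X, U)[C(U)/b]) ≫ (Spec Γ(X, U) → X)`. [cite: StacksProject, Tag 0804] -/
theorem IsBlowup.exists_blowupAlgebra_chart {X' X : Scheme.{u}} {π : X' ⟶ X}
    {C : X.IdealSheafData} (hπ : IsBlowup π C) (x' : X') :
    ∃ (U : X.affineOpens) (b : Γ(X, U)) (_ : b ∈ C.ideal U)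
      (g : Spec (.of (blowupAlgebra (C.ideal U) b)) ⟶ X'),
      IsOpenImmersion g ∧ x' ∈ Set.range g ∧
        g ≫ π = Spec.map (CommRingCat.ofHom (algebraMap Γ(X, U) (blowupAlgebra (C.ideal U) b))) ≫
          U.2.fromSpec := by
  obtain ⟨U, hU, hxU, -⟩ :=
    exists_isAffineOpen_mem_and_subset (X := X) (x := π x') (U := ⊤) (Opens.mem_top _)
  exact ⟨⟨U, hU⟩, hπ.exists_blowupAlgebra_chart_of_mem ⟨U, hU⟩ hxU⟩

/-- **Charts of a blow-up on sections**: for `π : X' → X` a blow-up along `C` and `x' ∈ X'`,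
there are affine opens `x' ∈ V ⊆ X'` and `U ⊆ X` with `π(V) ⊆ U`, an element `b ∈ C(U)`, and a
ring isomorphism `e : Γ(X', V) ≅ Γ(X, U)[C(U)/b]` onto the affine blowup algebra with
`e ∘ π^* = (Γ(X, U) → Γ(X, U)[C(U)/b])`, `π^* = π.appLE U V`. [cite: StacksProject, Tag 0804] -/
theorem IsBlowup.exists_chart {X' X : Scheme.{u}} {π : X' ⟶ X} {C : X.IdealSheafData}
    (hπ : IsBlowup π C) (x' : X') :
    ∃ (U : X.affineOpens) (V : X'.affineOpens) (hVU : (V : X'.Opens) ≤ π ⁻¹ᵁ (U : X.Opens))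
      (b : Γ(X, U)) (_ : b ∈ C.ideal U) (e : Γ(X', V) ≃+* blowupAlgebra (C.ideal U) b),
      x' ∈ (V : X'.Opens) ∧
        e.toRingHom.comp (π.appLE U V hVU).hom =
          algebraMap Γ(X, U) (blowupAlgebra (C.ideal U) b) := by
  obtain ⟨U, b, hb, g, hg, hx', hgπ⟩ := hπ.exists_blowupAlgebra_chart x'
  haveI := hg
  have hVU := image_top_le_preimage_of_comp_eq π g U _ hgπ
  have key := appLE_appIso_ΓSpecIso_of_comp_eq π g U _ hgπ hVU
  refine ⟨U, ⟨g ''ᵁ ⊤, (isAffineOpen_top _).image_of_isOpenImmersion g⟩, hVU, b, hb,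
    ((g.appIso ⊤) ≪≫ Scheme.ΓSpecIso _).commRingCatIsoToRingEquiv, ?_, ?_⟩
  · obtain ⟨z, rfl⟩ := hx'
    exact ⟨z, trivial, rfl⟩
  · have key' := congrArg CommRingCat.Hom.hom key
    rw [CommRingCat.hom_comp, CommRingCat.hom_ofHom] at key'
    exact key'

end Literature.AlgebraicGeometry.Resolution

end
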